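import Summits.QuantumFields.YangMills.Theorems.BalabanUVNodesSpineReadingOfRecord13CoPHKRatioDominationBanked

/-!
# N20 (NE7b) ON THE TOWER-FREE ROAD, END TO END WITH PRINT'S VARIABLE WINDOWS: at the CoPHK carriers of record, for ANY bad-key reading, the fibrewise letters with good images (L1), the
# removal data filed under birth slots (b), and the banked per-RECORD prices with EVENT-ATTACHED windows `y ≤ ρ_b·e^{−κ₁W_b}·Π_{e∈Q}(e^{−κ₁W_e}·η_e)` over the records counted EXACTLY
# (`T4PersistentHistoryCount.records ∕ slotPrice_le`) ⇒ `RelWeightBound 1 … (K ↦ 1 − exp(−S_K))`, `S_K = ρ̄e^{−κ₁}·V·r^{K − j⋆(K) + 1}∕(1 − r)`, `r = Λ·e^{η̄ − κ₁}` — no uniform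
# window, no event-number floor, no free budget parameter

Cell `pub-ymgap`, YM-PLAN Track A (HUMAN RULING D-0062); seat `pub-ymgap-dag-n20-d` (R134 (a) N20 NE7b s3), gen 40 — director-ym №374 line (E).  The twin of
`…CoPHKRatioDominationBankedWindow.relWeightBound_uniformWindow_of_fibreDomLetters_banked` (gen 40, p772634) with the uniform-window block replaced by the VARIABLE-WINDOW budget
`…N20FinalLevelBankedBudget.sum_stock_le_twoRate_of_records` (gen 40, p771116): print's windows creep along the run (`R_s` of (2.5) [III]; [LF-II] p. 386 renewal «K = R_{j+1}», p. 387
merger «K ≤ K₂ + n₁ + R_{j+1}»), so the faithful count attaches a window `W e` to each event and charges a record `Q` only through the span condition `K + 1 − j ≤ W b + Σ_{e∈Q} W e`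
(`T4PersistentHistoryCount.records`).  `--kind proof --supports stmt-QuantumFields-27366 --as helper` (K3⁸); COUNT-NEUTRAL; THEOREMS ONLY (0 `def`).  [IV] = [Balaban1989LargeFieldI];
[LF-II] = [Balaban1989LargeFieldII]; [III] = [Balaban1988Convergent].

WHAT IS PROVED.  ★★★ `relWeightBound_records_of_fibreDomLetters_banked` (the face with every hypothesis displayed in print's currency, variable windows; run A at level `K₀ + K` with cut
`K₀ + j⋆(K)`, run B at `K₀ + K + 1` with cut `K₀ + j⋆(K) + 1` give the SAME `S_K` (`omega`); the rate `r = Λ·e^{η̄−κ₁} < 1` is `T4PersistentHistoryCount.twoRate_lt_one_of_margin`'s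
«`d·log L + η̄ < κ₁`» at `Λ = L^d`).

HONEST FRAMING.  [bookkeeping].  Displayed hypotheses, each NOT PRINTED as a theorem of [LF-II] for `d = 4` and NOT proved here: (L1) the fibrewise letters (an ESTIMATE; junction NC-NE7b-α
UNRULED); (b) removal maps with good images, fibre injections, slot filing (a DEFINER object on def-T's index); (R1) the per-record prices `hy` (the cell's BANKING of print's credits —
`…N20BankedTerminalTerm` shows print's (1.80)⁺ induction tolerates it); the event universes, birth kinds, residual entropies `η ≤ η̄` per step, birth residuals `Σρ ≤ ρ̄` and cells `V·Λ^a`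
(READING (ID) of `T4PersistentHistoryCount`).  NO weight of Bałaban's is bounded, NO estimate proved; NE7 ∕ NE7b ∕ NE7c NOT PRINTED ∕ NOT proved; no `Provisos₁₃CoPH` inhabitant claimed
(K0⁷ OPEN); K3⁸ untouched; N20 NOT discharged; counts UNMOVED (typed 28∕28 · discharged 8∕27); one finite four-torus programme at fixed `ε` — NOT ℝ⁴, NOT OS, NOT a mass gap, NOT the
Clay problem.  No `def`, no `instance`, no `notation`, no `sorry`; no decl below carries a cite tag.
-/

noncomputable section

open MeasureTheory
open scoped BigOperators
open Finset

namespace YMDAG.UVSplit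

open Literature.MathematicalPhysics.QuantumFieldTheory.Balaban1983to89
open Literature.MathematicalPhysics.QuantumFieldTheory.Balaban1983to89.T4Continuum
open Literature.MathematicalPhysics.QuantumFieldTheory.Balaban1983to89.Node00
open Literature.MathematicalPhysics.QuantumFieldTheory.Balaban1983to89.B15.BasicStep (fibreIntegral)
open T4WeightBudget (RelWeightBound)
open T4PersistentHistoryCount (records)

variable {F : T4Family} {N : ℕ} [NeZero N]

section Face

variable (θ : Stage13HParams F N) (hP : θ.Provisos₁₃CoPH F N) (K₀ : ℕ) (g₀ : ℕ → ℝ) (os : List (ULoop F))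
  (kr : ℕ → (Σ K, SiteSeqKey F (K₀ + K)) → (Σ K, SiteSeqKey F (K₀ + K))) (bd : ℕ → (Σ K, SiteSeqKey F (K₀ + K)) → Prop)

open scoped Classical in
/-- ★★★ **THE N20 FACE ON THE TOWER-FREE ROAD WITH PRINT'S VARIABLE WINDOWS** (any bad-key reading `bd`; constants `V ≥ 0`, `Λ > 0`, `κ₁ ≥ 0`, `ρ̄ ≥ 0`, `η̄` with `Λ·e^{η̄−κ₁} < 1`, a cut
`j⋆(K) ≤ K` with `c·K ≤ K − j⋆(K)`, cells `#Cell a ≤ V·Λ^a`; per `(K, t)`, `|t| ≤ 1`, EACH RUN: the data of road [e] — removal map with good images, fibre sets, factors with the fibrewise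
letter on the bad-key histories, stocks with fibre injections and multiplicative majorants filed under birth slots older than the run's cut — and, per image `σ` and birth step `j`, an
event universe `Ev σ j` on the steps `(j, level]` with windows `Wn`, birth kinds `Bk σ j` with residuals `Σ ρk ≤ ρ̄`, per-step residual entropy `≤ η̄`, and per-record prices `y` carrying
the filed activities with `y ≤ ρk b·e^{−κ₁Wn b}·Π_{e∈Q}(e^{−κ₁Wn e}·η e)` over `Q ∈ records Wn j level (Ev σ j) b`; displayed measurability ∕ integrability of the dressed pieces) ⇒
`RelWeightBound 1 (classSetK₁₃ …) (weightAK₁₃ …) (weightBK₁₃ …) (badClassK₁₃ … bd) (K ↦ 1 − exp(−S_K))`, `S_K = ρ̄e^{−κ₁}·V·r^{K − j⋆(K) + 1}∕(1 − r)`, `r = Λ·e^{η̄−κ₁}`. [bookkeeping] -/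
theorem relWeightBound_records_of_fibreDomLetters_banked {X γ ε : Type*} [DecidableEq ε] {V Λ κ₁ ρbar ηbar c : ℝ} (hV : 0 ≤ V) (hΛ : 0 < Λ) (hκ : 0 ≤ κ₁)
    (hρbar : 0 ≤ ρbar) (hr : Λ * Real.exp (ηbar - κ₁) < 1) (hc : 0 < c) {jstar : ℕ → ℕ} (hjK : ∀ K, jstar K ≤ K) (hfrac : ∀ K : ℕ, c * K ≤ ((K - jstar K : ℕ) : ℝ))
    (Cell : ℕ → Finset γ) (hcell : ∀ a, ((Cell a).card : ℝ) ≤ V * Λ ^ a)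
    (hmA : ∀ K t s, Measurable fun V => chiSeqOfRecord F N θ.ν θ.τ9.M (histA₁₃ θ K₀ g₀ K) (K₀ + K) (K₀ + K) s V *
      dressedSlotsOfDatum₉ F N θ.toStage9Params (datumOfRecord₁₃CoPH F N θ hP) g₀ os t (runA₁₃ F K₀ g₀ K) (histA₁₃ θ K₀ g₀ K) (K₀ + K) s V)
    (hintA : ∀ K t s, Integrable (fun V => chiSeqOfRecord F N θ.ν θ.τ9.M (histA₁₃ θ K₀ g₀ K) (K₀ + K) (K₀ + K) s V *
      dressedSlotsOfDatum₉ F N θ.toStage9Params (datumOfRecord₁₃CoPH F N θ hP) g₀ os t (runA₁₃ F K₀ g₀ K) (histA₁₃ θ K₀ g₀ K) (K₀ + K) s V)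
      (fieldMeasure (F.P (K₀ + K)) (K₀ + K) (SU N)))
    (hmB : ∀ K t s', Measurable fun V => chiSeqOfRecord F N θ.ν θ.τ9.M (histB₁₃ θ K₀ g₀ K) (K₀ + K + 1) (K₀ + K + 1) s' V *
      dressedSlotsOfDatum₉ F N θ.toStage9Params (datumOfRecord₁₃CoPH F N θ hP) g₀ os t (runB₁₃ F K₀ g₀ K) (histB₁₃ θ K₀ g₀ K) (K₀ + K + 1) s' V)
    (hintB : ∀ K t s', Integrable (fun V => chiSeqOfRecord F N θ.ν θ.τ9.M (histB₁₃ θ K₀ g₀ K) (K₀ + K + 1) (K₀ + K + 1) s' V *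
      dressedSlotsOfDatum₉ F N θ.toStage9Params (datumOfRecord₁₃CoPH F N θ hP) g₀ os t (runB₁₃ F K₀ g₀ K) (histB₁₃ θ K₀ g₀ K) (K₀ + K + 1) s' V)
      (fieldMeasure (F.P (K₀ + K + 1)) (K₀ + K + 1) (SU N)))
    (hLA : ∀ (K : ℕ) (t : ℝ), |t| ≤ 1 →
      ∃ (rm : SeqOfRecord F θ.ν θ.τ9.M (histA₁₃ θ K₀ g₀ K) (K₀ + K) (K₀ + K) → SeqOfRecord F θ.ν θ.τ9.M (histA₁₃ θ K₀ g₀ K) (K₀ + K) (K₀ + K))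
        (fib : SeqOfRecord F θ.ν θ.τ9.M (histA₁₃ θ K₀ g₀ K) (K₀ + K) (K₀ + K) → Finset (PBond (F.P (K₀ + K)) (K₀ + K)))
        (z : SeqOfRecord F θ.ν θ.τ9.M (histA₁₃ θ K₀ g₀ K) (K₀ + K) (K₀ + K) → ℝ) (Old : SeqOfRecord F θ.ν θ.τ9.M (histA₁₃ θ K₀ g₀ K) (K₀ + K) (K₀ + K) → Finset X)
        (φ : SeqOfRecord F θ.ν θ.τ9.M (histA₁₃ θ K₀ g₀ K) (K₀ + K) (K₀ + K) → SeqOfRecord F θ.ν θ.τ9.M (histA₁₃ θ K₀ g₀ K) (K₀ + K) (K₀ + K) → Finset X) (x : X → ℝ)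
        (slot : SeqOfRecord F θ.ν θ.τ9.M (histA₁₃ θ K₀ g₀ K) (K₀ + K) (K₀ + K) → X → (Σ _ : ℕ, γ))
        (Wn : ε → ℕ) (step : ε → ℕ) (Ev Bk : SeqOfRecord F θ.ν θ.τ9.M (histA₁₃ θ K₀ g₀ K) (K₀ + K) (K₀ + K) → ℕ → Finset ε) (ρk η : ε → ℝ) (y : SeqOfRecord F θ.ν θ.τ9.M (histA₁₃ θ K₀ g₀ K) (K₀ + K) (K₀ + K) → ℕ → γ → ε → Finset ε → ℝ),
        (∀ s, kr K (keyA₁₃ θ K₀ g₀ K s) ∈ badClassK₁₃ θ K₀ g₀ kr bd K t → ∀ V,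
          fibreIntegral (fib s) (fun V => chiSeqOfRecord F N θ.ν θ.τ9.M (histA₁₃ θ K₀ g₀ K) (K₀ + K) (K₀ + K) s V *
              dressedSlotsOfDatum₉ F N θ.toStage9Params (datumOfRecord₁₃CoPH F N θ hP) g₀ os t (runA₁₃ F K₀ g₀ K) (histA₁₃ θ K₀ g₀ K) (K₀ + K) s V) V ≤
            z s * fibreIntegral (fib s) (fun V => chiSeqOfRecord F N θ.ν θ.τ9.M (histA₁₃ θ K₀ g₀ K) (K₀ + K) (K₀ + K) (rm s) V *
              dressedSlotsOfDatum₉ F N θ.toStage9Params (datumOfRecord₁₃CoPH F N θ hP) g₀ os t (runA₁₃ F K₀ g₀ K) (histA₁₃ θ K₀ g₀ K) (K₀ + K) (rm s) V) V) ∧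
        (∀ s, kr K (keyA₁₃ θ K₀ g₀ K s) ∈ badClassK₁₃ θ K₀ g₀ kr bd K t → kr K (keyA₁₃ θ K₀ g₀ K (rm s)) ∉ badClassK₁₃ θ K₀ g₀ kr bd K t) ∧
        (∀ σ, ∀ Y ∈ Old σ, 0 ≤ x Y) ∧
        (∀ σ s, kr K (keyA₁₃ θ K₀ g₀ K s) ∈ badClassK₁₃ θ K₀ g₀ kr bd K t → rm s = σ → φ σ s ⊆ Old σ ∧ (φ σ s).Nonempty) ∧
        (∀ σ, Set.InjOn (φ σ) {s | kr K (keyA₁₃ θ K₀ g₀ K s) ∈ badClassK₁₃ θ K₀ g₀ kr bd K t ∧ rm s = σ}) ∧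
        (∀ σ s, kr K (keyA₁₃ θ K₀ g₀ K s) ∈ badClassK₁₃ θ K₀ g₀ kr bd K t → rm s = σ → z s ≤ ∏ Y ∈ φ σ s, x Y) ∧
        (∀ σ, ∀ Y ∈ Old σ, (slot σ Y).1 < (K₀ + jstar K)) ∧ (∀ σ, ∀ Y ∈ Old σ, (slot σ Y).2 ∈ Cell ((K₀ + K) - (slot σ Y).1)) ∧
        (∀ σ j, ∀ e ∈ Ev σ j, step e ∈ Finset.Ioc j (K₀ + K)) ∧ (∀ σ j, ∀ b ∈ Bk σ j, 0 ≤ ρk b) ∧ (∀ σ j, ∑ b ∈ Bk σ j, ρk b ≤ ρbar) ∧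
        (∀ σ j, ∀ e ∈ Ev σ j, 0 ≤ η e) ∧ (∀ σ j, ∀ τ ∈ Finset.Ioc j (K₀ + K), ∑ e ∈ Ev σ j with step e = τ, η e ≤ ηbar) ∧
        (∀ σ, ∀ j < (K₀ + jstar K), ∀ cz ∈ Cell ((K₀ + K) - j),
          ∑ Y ∈ Old σ with slot σ Y = ⟨j, cz⟩, x Y ≤ ∑ b ∈ Bk σ j, ∑ Q ∈ records Wn j (K₀ + K) (Ev σ j) b, y σ j cz b Q) ∧
        (∀ σ, ∀ j < (K₀ + jstar K), ∀ cz ∈ Cell ((K₀ + K) - j), ∀ b ∈ Bk σ j, ∀ Q ∈ records Wn j (K₀ + K) (Ev σ j) b,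
          y σ j cz b Q ≤ ρk b * Real.exp (-(κ₁ * Wn b)) * ∏ e ∈ Q, (Real.exp (-(κ₁ * Wn e)) * η e)))
    (hLB : ∀ (K : ℕ) (t : ℝ), |t| ≤ 1 →
      ∃ (rm : SeqOfRecord F θ.ν θ.τ9.M (histB₁₃ θ K₀ g₀ K) (K₀ + K + 1) (K₀ + K + 1) → SeqOfRecord F θ.ν θ.τ9.M (histB₁₃ θ K₀ g₀ K) (K₀ + K + 1) (K₀ + K + 1))
        (fib : SeqOfRecord F θ.ν θ.τ9.M (histB₁₃ θ K₀ g₀ K) (K₀ + K + 1) (K₀ + K + 1) → Finset (PBond (F.P (K₀ + K + 1)) (K₀ + K + 1)))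
        (z : SeqOfRecord F θ.ν θ.τ9.M (histB₁₃ θ K₀ g₀ K) (K₀ + K + 1) (K₀ + K + 1) → ℝ) (Old : SeqOfRecord F θ.ν θ.τ9.M (histB₁₃ θ K₀ g₀ K) (K₀ + K + 1) (K₀ + K + 1) → Finset X)
        (φ : SeqOfRecord F θ.ν θ.τ9.M (histB₁₃ θ K₀ g₀ K) (K₀ + K + 1) (K₀ + K + 1) → SeqOfRecord F θ.ν θ.τ9.M (histB₁₃ θ K₀ g₀ K) (K₀ + K + 1) (K₀ + K + 1) → Finset X) (x : X → ℝ)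
        (slot : SeqOfRecord F θ.ν θ.τ9.M (histB₁₃ θ K₀ g₀ K) (K₀ + K + 1) (K₀ + K + 1) → X → (Σ _ : ℕ, γ))
        (Wn : ε → ℕ) (step : ε → ℕ) (Ev Bk : SeqOfRecord F θ.ν θ.τ9.M (histB₁₃ θ K₀ g₀ K) (K₀ + K + 1) (K₀ + K + 1) → ℕ → Finset ε) (ρk η : ε → ℝ) (y : SeqOfRecord F θ.ν θ.τ9.M (histB₁₃ θ K₀ g₀ K) (K₀ + K + 1) (K₀ + K + 1) → ℕ → γ → ε → Finset ε → ℝ),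
        (∀ s', kr K (keyB₁₃ θ K₀ g₀ K s') ∈ badClassK₁₃ θ K₀ g₀ kr bd K t → ∀ V,
          fibreIntegral (fib s') (fun V => chiSeqOfRecord F N θ.ν θ.τ9.M (histB₁₃ θ K₀ g₀ K) (K₀ + K + 1) (K₀ + K + 1) s' V *
              dressedSlotsOfDatum₉ F N θ.toStage9Params (datumOfRecord₁₃CoPH F N θ hP) g₀ os t (runB₁₃ F K₀ g₀ K) (histB₁₃ θ K₀ g₀ K) (K₀ + K + 1) s' V) V ≤
            z s' * fibreIntegral (fib s') (fun V => chiSeqOfRecord F N θ.ν θ.τ9.M (histB₁₃ θ K₀ g₀ K) (K₀ + K + 1) (K₀ + K + 1) (rm s') V *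
              dressedSlotsOfDatum₉ F N θ.toStage9Params (datumOfRecord₁₃CoPH F N θ hP) g₀ os t (runB₁₃ F K₀ g₀ K) (histB₁₃ θ K₀ g₀ K) (K₀ + K + 1) (rm s') V) V) ∧
        (∀ s', kr K (keyB₁₃ θ K₀ g₀ K s') ∈ badClassK₁₃ θ K₀ g₀ kr bd K t → kr K (keyB₁₃ θ K₀ g₀ K (rm s')) ∉ badClassK₁₃ θ K₀ g₀ kr bd K t) ∧
        (∀ σ, ∀ Y ∈ Old σ, 0 ≤ x Y) ∧
        (∀ σ s', kr K (keyB₁₃ θ K₀ g₀ K s') ∈ badClassK₁₃ θ K₀ g₀ kr bd K t → rm s' = σ → φ σ s' ⊆ Old σ ∧ (φ σ s').Nonempty) ∧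
        (∀ σ, Set.InjOn (φ σ) {s' | kr K (keyB₁₃ θ K₀ g₀ K s') ∈ badClassK₁₃ θ K₀ g₀ kr bd K t ∧ rm s' = σ}) ∧
        (∀ σ s', kr K (keyB₁₃ θ K₀ g₀ K s') ∈ badClassK₁₃ θ K₀ g₀ kr bd K t → rm s' = σ → z s' ≤ ∏ Y ∈ φ σ s', x Y) ∧
        (∀ σ, ∀ Y ∈ Old σ, (slot σ Y).1 < (K₀ + jstar K + 1)) ∧ (∀ σ, ∀ Y ∈ Old σ, (slot σ Y).2 ∈ Cell ((K₀ + K + 1) - (slot σ Y).1)) ∧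
        (∀ σ j, ∀ e ∈ Ev σ j, step e ∈ Finset.Ioc j (K₀ + K + 1)) ∧ (∀ σ j, ∀ b ∈ Bk σ j, 0 ≤ ρk b) ∧ (∀ σ j, ∑ b ∈ Bk σ j, ρk b ≤ ρbar) ∧
        (∀ σ j, ∀ e ∈ Ev σ j, 0 ≤ η e) ∧ (∀ σ j, ∀ τ ∈ Finset.Ioc j (K₀ + K + 1), ∑ e ∈ Ev σ j with step e = τ, η e ≤ ηbar) ∧
        (∀ σ, ∀ j < (K₀ + jstar K + 1), ∀ cz ∈ Cell ((K₀ + K + 1) - j),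
          ∑ Y ∈ Old σ with slot σ Y = ⟨j, cz⟩, x Y ≤ ∑ b ∈ Bk σ j, ∑ Q ∈ records Wn j (K₀ + K + 1) (Ev σ j) b, y σ j cz b Q) ∧
        (∀ σ, ∀ j < (K₀ + jstar K + 1), ∀ cz ∈ Cell ((K₀ + K + 1) - j), ∀ b ∈ Bk σ j, ∀ Q ∈ records Wn j (K₀ + K + 1) (Ev σ j) b,
          y σ j cz b Q ≤ ρk b * Real.exp (-(κ₁ * Wn b)) * ∏ e ∈ Q, (Real.exp (-(κ₁ * Wn e)) * η e))) :
    RelWeightBound 1 (classSetK₁₃ θ K₀ g₀ kr) (weightAK₁₃ θ hP K₀ g₀ os kr) (weightBK₁₃ θ hP K₀ g₀ os kr) (badClassK₁₃ θ K₀ g₀ kr bd)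
      (fun K => 1 - Real.exp (-(ρbar * Real.exp (-κ₁) * V *
        ((Λ * Real.exp (ηbar - κ₁)) ^ (K - jstar K + 1) / (1 - Λ * Real.exp (ηbar - κ₁)))))) := by
  have hr0 : 0 < Λ * Real.exp (ηbar - κ₁) := mul_pos hΛ (Real.exp_pos _)
  have hC : 0 ≤ ρbar * Real.exp (-κ₁) := mul_nonneg hρbar (Real.exp_pos _).le
  refine relWeightBound_twoRate_of_fibreDomLetters_banked (X := X) θ hP K₀ g₀ os kr bd hC hV hr0 hr hc hfrac hmA hintA hmB hintB ?_ ?_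
  · intro K t ht
    obtain ⟨rm, fib, z, Old, φ, x, slot, Wn, step, Ev, Bk, ρk, η, y, hDom, hgood, hx, hφ, hinj, hz, hold, hmem, hE, hρ, hρb, hη, hηb, hfile, hy⟩ := hLA K t ht
    refine ⟨rm, fib, z, Old, φ, x, hDom, hgood, hx, hφ, hinj, hz, fun σ => ?_⟩
    have h := sum_stock_le_twoRate_of_records (Old σ) (slot σ) x Cell hV hΛ.le hcell Wn step (Ev σ) (Bk σ) (hE σ) hκ ρk (hρ σ) (hρb σ) η (hη σ) (hηb σ) hr
      (show K₀ + jstar K ≤ K₀ + K from Nat.add_le_add_left (hjK K) K₀) (hold σ) (hmem σ) (y σ) (hfile σ) (hy σ)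
    rw [show K₀ + K - (K₀ + jstar K) = K - jstar K by omega] at h
    exact h
  · intro K t ht
    obtain ⟨rm, fib, z, Old, φ, x, slot, Wn, step, Ev, Bk, ρk, η, y, hDom, hgood, hx, hφ, hinj, hz, hold, hmem, hE, hρ, hρb, hη, hηb, hfile, hy⟩ := hLB K t ht
    refine ⟨rm, fib, z, Old, φ, x, hDom, hgood, hx, hφ, hinj, hz, fun σ => ?_⟩
    have h := sum_stock_le_twoRate_of_records (Old σ) (slot σ) x Cell hV hΛ.le hcell Wn step (Ev σ) (Bk σ) (hE σ) hκ ρk (hρ σ) (hρb σ) η (hη σ) (hηb σ) hr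
      (show K₀ + jstar K + 1 ≤ K₀ + K + 1 from Nat.succ_le_succ (Nat.add_le_add_left (hjK K) K₀)) (hold σ) (hmem σ) (y σ) (hfile σ) (hy σ)
    rw [show K₀ + K + 1 - (K₀ + jstar K + 1) = K - jstar K by omega] at h
    exact h

end Face

end YMDAG.UVSplit
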